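import Literature.Analysis.FluidPDE.NovackMatrixKernel
import Literature.Analysis.FluidPDE.DuchonRobertCubicIdentity
import HarnessLib

/-!
# Novack's matrix cubic identity — discharge of `Torus.integral_matKernelFlux_mul_eq`

Topic: Analysis/FluidPDE, proofs companion to `Literature.Analysis.FluidPDE.NovackMatrixKernel`.

Sorry-free proof `Torus.integral_matKernelFlux_mul_eq_holds` of the named fact
`Torus.integral_matKernelFlux_mul_eq` (M. Novack, *Scaling laws and exact results in turbulence*,
Nonlinearity 37 (2024) 095002, §2 Step 2, (mess:one), first equality: "by direct computation,
using that `∇·u = 0`, `⟨u, T_• u⟩ = ⟨T_• u, T_• u⟩`, and the spherical symmetry of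
`φ_{ℓ,γ}T_•` and anti-symmetry of its gradient `∇(φ_{ℓ,γ}T_•)`, we may rewrite the last term from
(last:one:L) as `−½ ∫∫∫ φ ∂_{y_k}(T^{ij}_• φ_{ℓ,γ}) δuⁱ δuʲ δuᵏ dy dt dx`"), in its tested torus
form for a general smooth, even, symmetric matrix kernel `M = (M i j)`:
`∫₀ᵀ∫ 𝒟_M(u) ψ = ∫₀ᵀ∫ ⟪(u|u_M|²), ∇ψ⟫ − ∫₀ᵀ∫ (|u_M|²) ⟪u, ∇ψ⟫ + 2∫₀ᵀ∫ ⟪u, u_M⟫⟪u, ∇ψ⟫ − 2∫₀ᵀ∫ ⟪u, (u·∇)Φ_M⟫`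
(`𝒟_M = matKernelFlux M`, `u_M = matConv`, `(|u_M|²) = matConvSq`, `(u|u_M|²) = matConvCube`,
`Φ_M = ψ u_M + (ψ u)_M = matSymmTestField`), for jointly measurable `u ∈ L³((0,T) × T^d)` weakly
divergence free for a.e. `t`. This is the matrix twin of the tree's discharge
`Torus.integral_kernelFlux_mul_eq_holds` (`DuchonRobertCubicIdentity`, the scalar kernel
`M i j = δᵢⱼ K` of Duchon–Robert 2000, proof of Prop. 1), whose architecture and lemmas are reused.

## The proof

* **Kernel calculus** (`integral_mul_translate_of_odd`): for an odd kernel `L` and `f ∈ L¹`,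
  `∫ L(z) f(x + z) dz = -(f ⋆ L)(x)`; applied to `L = ∂ₖ(M i j)` (odd, `M i j` being even).
* **Entrywise expansion** (`integral_partialDeriv_mul_increment₃`): with `a = v(x+z)`, `b = v(x)`,
  `δ = a − b`, expanding `δᵢδⱼδₖ` in its eight monomials and integrating each against `∂ₗK(z) dz`,
  `∫ ∂ₗK δᵢδⱼδₖ = −(vᵢvⱼvₖ)⋆∂ₗK + bₖ (vᵢvⱼ)⋆∂ₗK + bⱼ (vᵢvₖ)⋆∂ₗK + bᵢ (vⱼvₖ)⋆∂ₗK − bⱼbₖ vᵢ⋆∂ₗK − bᵢbₖ vⱼ⋆∂ₗK − bᵢbⱼ vₖ⋆∂ₗK`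
  (the constant monomial drops by `∫ ∂ₗK = 0`).
* **Pointwise identity** (`matKernelFlux_eq_sum`): summing over `i, j, k` (`l = k`), the terms
  `bᵢ(vⱼvₖ)`, `bᵢbₖvⱼ` coincide with `bⱼ(vᵢvₖ)`, `bⱼbₖvᵢ` by the symmetry `M i j = M j i`, and
  `∑ₖ vₖ ⋆ ∂ₖ(M i j) = 0` by weak divergence-freeness (`Torus.sum_convolution_partialDeriv_eq_zero`):
  `𝒟_M(v)(x) = −∑ᵢⱼₖ((vᵢvⱼvₖ)⋆∂ₖM^{ij})(x) + ∑ᵢⱼₖ vₖ(x)((vᵢvⱼ)⋆∂ₖM^{ij})(x) + 2∑ᵢⱼₖ vⱼ(x)((vᵢvₖ)⋆∂ₖM^{ij})(x) − 2∑ᵢⱼₖ vⱼ(x)vₖ(x)(vᵢ⋆∂ₖM^{ij})(x)`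
  (Novack's `−div V_M + u·∇S_M + 2uʲ∂ₖW^{jk} − 2uʲuᵏ∂ₖu_Mʲ`).
* **Slice identity** (`integral_matKernelFlux_mul_slice`): integrate against a smooth `χ`; the
  first term is `−∫ χ div (u|u_M|²) = ∫ ⟪(u|u_M|²), ∇χ⟫` (integration by parts), the second is
  `∫ χ ⟪v, ∇(|u_M|²)⟫ = −∫ (|u_M|²)⟪v, ∇χ⟫` (weak divergence-freeness against `(|u_M|²)χ`), the
  third becomes `−2∫ ∑ ((χvⱼ)⋆∂ₖM^{ij}) vᵢvₖ` by the odd adjointness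
  `∫ f (g ⋆ ∂ₖM) = −∫ (f ⋆ ∂ₖM) g` (`integral_mul_convolution_odd`), and the coordinate expansion
  `⟪v,(v·∇)Φ_M⟫ = ⟪v,v_M⟫⟪v,∇χ⟫ + χ∑ vⱼvₖ(vᵢ⋆∂ₖM^{ji}) + ∑ vᵢvₖ((χvⱼ)⋆∂ₖM^{ij})`
  (`inner_convect_eq_sum`, `partialDeriv_matSymmTestField`) closes the algebra.
* **Space–time** (`integral_matKernelFlux_mul_eq_holds`): the slice identity for a.e. `t` and
  Fubini; the product integrands are dominated by `∫|u(t)|³`, `(∫|u(t)|²)|u(t,x)|`,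
  `(∫|u(t)|)|u(t,x)|²` (`integrable_slice_dominations`) and the flux by
  `|𝒟_M(v)(x)| ≤ 4C (∫|v|³ + |v(x)|³)` (`abs_matKernelFlux_le`).

## References

* M. Novack, *Scaling laws and exact results in turbulence*, Nonlinearity 37 (2024) 095002,
  arXiv:2310.01375, §2 Step 2 ((last:one:L), (mess:one) first equality; p. 8 of the arXiv
  source). [Novack2024]
* J. Duchon, R. Robert, Nonlinearity 13 (2000) 249–255, proof of Prop. 1, pp. 250–251 (the scalar
  computation). [DuchonRobert2000]

## Mathlib / tree

Mathlib: group convolution (`convolution_lsmul`), `integral_add_left_eq_self`, Fubini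
(`Integrable.integral_prod_left`), `Finset.sum_comm`. Tree: `DuchonRobertCubicIdentity`
(`partialDeriv_neg_of_even`, `integral_mul_convolution_odd`, `inner_convect_eq_sum`,
`gradient_mul_of_isContDiff`, `integrable_slice_dominations`, `ae_prod_of_ae_left`,
`MemLp.integrable_norm_pow_three_and_sq`, `integrable_apply_mul_apply`), `NovackMatrixKernel`
(`partialDeriv_matSymmTestField`, `continuous_matConv`), `TorusConvolution`
(`partialDeriv_convolution`, `isSmooth_convolution`, `norm_convolution_le`,
`aestronglyMeasurable_uncurry_convolution`), `OnsagerCCFSTestField`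
(`sum_convolution_partialDeriv_eq_zero`, `ae_memLp_three_of_lintegral`), `DuchonRobertShellLaw`
(`aestronglyMeasurable_translate`, `norm_sub_pow_three_le`, `integrable_norm_pow_three`).
-/

noncomputable section

open MeasureTheory TopologicalSpace Set Function Filter Metric
open _root_.Topology
open scoped ENNReal NNReal Convolution ContDiff InnerProductSpace RealInnerProductSpace

namespace Literature.Analysis.FluidPDE.Torus

variable {d : Type*} [Fintype d] [DecidableEq d]

/-! ## Kernel calculus: pairing a translate with an odd kernel -/

section KernelCalculus

variable {v : UnitAddTorus d → EuclideanSpace ℝ d}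

omit [DecidableEq d] in
/-- `z ↦ L(z) f(x + z)` is integrable for a continuous (hence bounded) `L` and `f ∈ L¹(T^d)`
(translation invariance of Haar measure). [folklore] -/
theorem integrable_mul_translate {L f : UnitAddTorus d → ℝ} (hL : Continuous L)
    (hf : Integrable f volume) (x : UnitAddTorus d) :
    Integrable (fun z => L z * f (x + z)) volume := by
  obtain ⟨C, hC⟩ := FunctionSpaces.Torus.exists_forall_norm_le_of_continuous hL
  exact (hf.comp_add_left x).bdd_mul hL.aestronglyMeasurable (ae_of_all _ hC)

omit [Fintype d] [DecidableEq d] in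
/-- **The scalar kernel identity**: `∫ L(z) f(x + z) dz = -(f ⋆ L)(x)` for an odd kernel `L`
(substitute `y = x + z`, translation invariance, and `L(y − x) = −L(x − y)`). [folklore] -/
theorem integral_mul_translate_of_odd [Fintype d] {L f : UnitAddTorus d → ℝ}
    (hLo : ∀ z, L (-z) = -L z) (x : UnitAddTorus d) :
    ∫ z, L z * f (x + z) = -(f ⋆ L) x := by
  have hsub : (∫ z, L z * f (x + z)) = ∫ y, L (y - x) * f y := by
    rw [← integral_add_left_eq_self (μ := (volume : Measure (UnitAddTorus d)))
      (fun y => L (y - x) * f y) x]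
    refine integral_congr_ae (ae_of_all _ fun z => ?_)
    simp only [add_sub_cancel_left]
  rw [hsub, convolution_lsmul, ← integral_neg]
  refine integral_congr_ae (ae_of_all _ fun y => ?_)
  simp only [smul_eq_mul]
  rw [show y - x = -(x - y) by abel, hLo]
  ring

omit [DecidableEq d] in
/-- Triple products of coordinates of an `L³` field are integrable. [folklore] -/
theorem integrable_apply_mul_apply_mul_apply (hv : MemLp v 3 volume) (i j k : d) :
    Integrable (fun y => v y i * v y j * v y k) volume := by
  obtain ⟨I3, -, -⟩ := MemLp.integrable_norm_pow_three_and_sq hv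
  have hmi : ∀ l, AEStronglyMeasurable (fun y => v y l) volume := fun l =>
    (EuclideanSpace.proj (𝕜 := ℝ) l).continuous.comp_aestronglyMeasurable hv.1
  refine I3.mono' (((hmi i).mul (hmi j)).mul (hmi k)) (ae_of_all _ fun y => ?_)
  rw [norm_mul, norm_mul]
  have hi := PiLp.norm_apply_le (v y) i
  have hj := PiLp.norm_apply_le (v y) j
  have hk := PiLp.norm_apply_le (v y) k
  calc ‖v y i‖ * ‖v y j‖ * ‖v y k‖ ≤ ‖v y‖ * ‖v y‖ * ‖v y‖ :=
        mul_le_mul (mul_le_mul hi hj (norm_nonneg _) (norm_nonneg _)) hk (norm_nonneg _)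
          (mul_nonneg (norm_nonneg _) (norm_nonneg _))
    _ = ‖v y‖ ^ 3 := by ring

/-- **Entrywise expansion of the cubic increment against a derivative kernel**: for a smooth even
scalar kernel `K`, an `L³` field `v`, indices `i j k l` and a base point `x`, with `b = v(x)`,
`∫ ∂ₗK(z) δvᵢδvⱼδvₖ dz = −((vᵢvⱼvₖ)⋆∂ₗK)(x) + bₖ((vᵢvⱼ)⋆∂ₗK)(x) + bⱼ((vᵢvₖ)⋆∂ₗK)(x) + bᵢ((vⱼvₖ)⋆∂ₗK)(x) − bⱼbₖ(vᵢ⋆∂ₗK)(x) − bᵢbₖ(vⱼ⋆∂ₗK)(x) − bᵢbⱼ(vₖ⋆∂ₗK)(x)`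
(expand the product in its eight monomials; each translate pairs with the odd kernel `∂ₗK` by
`integral_mul_translate_of_odd`; the constant monomial drops by `∫ ∂ₗK = 0`). [folklore] -/
theorem integral_partialDeriv_mul_increment₃ {K : UnitAddTorus d → ℝ}
    (hK : FunctionSpaces.Torus.IsSmooth K) (hKev : ∀ z, K (-z) = K z) (hv : MemLp v 3 volume)
    (i j k l : d) (x : UnitAddTorus d) :
    ∫ z, FunctionSpaces.Torus.partialDeriv l K z *
        ((v (x + z) - v x) i * (v (x + z) - v x) j * (v (x + z) - v x) k) =
      -((fun y => v y i * v y j * v y k) ⋆ FunctionSpaces.Torus.partialDeriv l K) x +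
        v x k * ((fun y => v y i * v y j) ⋆ FunctionSpaces.Torus.partialDeriv l K) x +
        v x j * ((fun y => v y i * v y k) ⋆ FunctionSpaces.Torus.partialDeriv l K) x +
        v x i * ((fun y => v y j * v y k) ⋆ FunctionSpaces.Torus.partialDeriv l K) x -
        v x j * v x k * ((fun y => v y i) ⋆ FunctionSpaces.Torus.partialDeriv l K) x -
        v x i * v x k * ((fun y => v y j) ⋆ FunctionSpaces.Torus.partialDeriv l K) x -
        v x i * v x j * ((fun y => v y k) ⋆ FunctionSpaces.Torus.partialDeriv l K) x := by
  obtain ⟨-, I2, I1⟩ := MemLp.integrable_norm_pow_three_and_sq hv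
  have hK1 : FunctionSpaces.Torus.IsContDiff 1 K := hK.isContDiff (by simp)
  set L := FunctionSpaces.Torus.partialDeriv l K with hL
  have hLc : Continuous L := (hK.partialDeriv l).continuous
  have hLo : ∀ z, L (-z) = -L z := partialDeriv_neg_of_even hK1 hKev l
  have hL0 : ∫ z, L z = 0 := FunctionSpaces.Torus.integral_partialDeriv_eq_zero_holds hK l
  have hLi : Integrable L volume := hLc.integrable_unitAddTorus
  -- the seven integrable factors and their translate pairings
  have hvi : ∀ m, Integrable (fun y => v y m) volume := fun m => I1.eval_piLp m
  have hvv : ∀ m n, Integrable (fun y => v y m * v y n) volume := fun m n =>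
    integrable_apply_mul_apply hv.1 I2 m n
  have hvvv : Integrable (fun y => v y i * v y j * v y k) volume :=
    integrable_apply_mul_apply_mul_apply hv i j k
  have T : ∀ {f : UnitAddTorus d → ℝ}, Integrable f volume →
      Integrable (fun z => L z * f (x + z)) volume := fun hf => integrable_mul_translate hLc hf x
  have E : ∀ f : UnitAddTorus d → ℝ, ∫ z, L z * f (x + z) = -(f ⋆ L) x :=
    fun f => integral_mul_translate_of_odd hLo x
  set b : EuclideanSpace ℝ d := v x with hb
  -- the eight monomials
  have i1 : Integrable (fun z => L z * (v (x + z) i * v (x + z) j * v (x + z) k)) volume := T hvvv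
  have i2 : Integrable (fun z => b k * (L z * (v (x + z) i * v (x + z) j))) volume :=
    (T (hvv i j)).const_mul _
  have i3 : Integrable (fun z => b j * (L z * (v (x + z) i * v (x + z) k))) volume :=
    (T (hvv i k)).const_mul _
  have i4 : Integrable (fun z => b i * (L z * (v (x + z) j * v (x + z) k))) volume :=
    (T (hvv j k)).const_mul _
  have i5 : Integrable (fun z => b j * b k * (L z * v (x + z) i)) volume := (T (hvi i)).const_mul _
  have i6 : Integrable (fun z => b i * b k * (L z * v (x + z) j)) volume := (T (hvi j)).const_mul _
  have i7 : Integrable (fun z => b i * b j * (L z * v (x + z) k)) volume := (T (hvi k)).const_mul _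
  have i8 : Integrable (fun z => b i * b j * b k * L z) volume := hLi.const_mul _
  have e1 : ∫ z, L z * (v (x + z) i * v (x + z) j * v (x + z) k) =
      -((fun y => v y i * v y j * v y k) ⋆ L) x := E (fun y => v y i * v y j * v y k)
  have e2 : ∫ z, L z * (v (x + z) i * v (x + z) j) = -((fun y => v y i * v y j) ⋆ L) x :=
    E (fun y => v y i * v y j)
  have e3 : ∫ z, L z * (v (x + z) i * v (x + z) k) = -((fun y => v y i * v y k) ⋆ L) x :=
    E (fun y => v y i * v y k)
  have e4 : ∫ z, L z * (v (x + z) j * v (x + z) k) = -((fun y => v y j * v y k) ⋆ L) x :=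
    E (fun y => v y j * v y k)
  have e5 : ∫ z, L z * v (x + z) i = -((fun y => v y i) ⋆ L) x := E (fun y => v y i)
  have e6 : ∫ z, L z * v (x + z) j = -((fun y => v y j) ⋆ L) x := E (fun y => v y j)
  have e7 : ∫ z, L z * v (x + z) k = -((fun y => v y k) ⋆ L) x := E (fun y => v y k)
  -- expansion of the integrand
  have hpt : ∀ z, L z * ((v (x + z) - b) i * (v (x + z) - b) j * (v (x + z) - b) k) =
      L z * (v (x + z) i * v (x + z) j * v (x + z) k) -
        b k * (L z * (v (x + z) i * v (x + z) j)) -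
        b j * (L z * (v (x + z) i * v (x + z) k)) -
        b i * (L z * (v (x + z) j * v (x + z) k)) +
        b j * b k * (L z * v (x + z) i) +
        b i * b k * (L z * v (x + z) j) +
        b i * b j * (L z * v (x + z) k) -
        b i * b j * b k * L z := by
    intro z
    simp only [PiLp.sub_apply]
    ring
  -- partial sums
  have s2 : Integrable (fun z => L z * (v (x + z) i * v (x + z) j * v (x + z) k) -
      b k * (L z * (v (x + z) i * v (x + z) j))) volume := i1.sub i2
  have s3 : Integrable (fun z => L z * (v (x + z) i * v (x + z) j * v (x + z) k) -
      b k * (L z * (v (x + z) i * v (x + z) j)) -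
      b j * (L z * (v (x + z) i * v (x + z) k))) volume := s2.sub i3
  have s4 : Integrable (fun z => L z * (v (x + z) i * v (x + z) j * v (x + z) k) -
      b k * (L z * (v (x + z) i * v (x + z) j)) -
      b j * (L z * (v (x + z) i * v (x + z) k)) -
      b i * (L z * (v (x + z) j * v (x + z) k))) volume := s3.sub i4
  have s5 : Integrable (fun z => L z * (v (x + z) i * v (x + z) j * v (x + z) k) -
      b k * (L z * (v (x + z) i * v (x + z) j)) -
      b j * (L z * (v (x + z) i * v (x + z) k)) -
      b i * (L z * (v (x + z) j * v (x + z) k)) +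
      b j * b k * (L z * v (x + z) i)) volume := s4.add i5
  have s6 : Integrable (fun z => L z * (v (x + z) i * v (x + z) j * v (x + z) k) -
      b k * (L z * (v (x + z) i * v (x + z) j)) -
      b j * (L z * (v (x + z) i * v (x + z) k)) -
      b i * (L z * (v (x + z) j * v (x + z) k)) +
      b j * b k * (L z * v (x + z) i) +
      b i * b k * (L z * v (x + z) j)) volume := s5.add i6
  have s7 : Integrable (fun z => L z * (v (x + z) i * v (x + z) j * v (x + z) k) -
      b k * (L z * (v (x + z) i * v (x + z) j)) -
      b j * (L z * (v (x + z) i * v (x + z) k)) -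
      b i * (L z * (v (x + z) j * v (x + z) k)) +
      b j * b k * (L z * v (x + z) i) +
      b i * b k * (L z * v (x + z) j) +
      b i * b j * (L z * v (x + z) k)) volume := s6.add i7
  rw [integral_congr_ae (ae_of_all _ hpt), integral_sub s7 i8, integral_add s6 i7,
    integral_add s5 i6, integral_add s4 i5, integral_sub s3 i4, integral_sub s2 i3,
    integral_sub i1 i2, integral_const_mul, integral_const_mul, integral_const_mul,
    integral_const_mul, integral_const_mul, integral_const_mul, integral_const_mul,
    e1, e2, e3, e4, e5, e6, e7, hL0]
  ring

end KernelCalculus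

/-! ## The pointwise identity -/

section Pointwise

variable {M : d → d → UnitAddTorus d → ℝ} {v : UnitAddTorus d → EuclideanSpace ℝ d}

/-- The entries `z ↦ ∂ₖ(M i j)(z) δvᵢ δvⱼ δvₖ` of the matrix flux integrand are integrable for
`v ∈ L³` and smooth `M` (`|δvᵢδvⱼδvₖ| ≤ |δv|³ ≤ 4(|v(x+z)|³ + |v(x)|³)`). [folklore] -/
theorem integrable_matKernelFlux_entry (hM : ∀ i j, FunctionSpaces.Torus.IsSmooth (M i j))
    (hv : MemLp v 3 volume) (x : UnitAddTorus d) (i j k : d) :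
    Integrable (fun z => FunctionSpaces.Torus.partialDeriv k (M i j) z *
      ((v (x + z) - v x) i * (v (x + z) - v x) j * (v (x + z) - v x) k)) volume := by
  obtain ⟨I3, -, I1⟩ := MemLp.integrable_norm_pow_three_and_sq hv
  have hδm : AEStronglyMeasurable (fun z => v (x + z) - v x) volume :=
    (I1.comp_add_left x).1.sub aestronglyMeasurable_const
  have hδi : ∀ m, AEStronglyMeasurable (fun z => (v (x + z) - v x) m) volume := fun m =>
    (EuclideanSpace.proj (𝕜 := ℝ) m).continuous.comp_aestronglyMeasurable hδm
  obtain ⟨C, hC⟩ := FunctionSpaces.Torus.exists_forall_norm_le_of_continuous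
    ((hM i j).partialDeriv k).continuous
  have hC0 : 0 ≤ C := (norm_nonneg _).trans (hC 0)
  have hdom : Integrable (fun z => C * (4 * (‖v (x + z)‖ ^ 3 + ‖v x‖ ^ 3))) volume :=
    (((I3.comp_add_left x).add (integrable_const _)).const_mul 4).const_mul C
  refine hdom.mono' (((hM i j).partialDeriv k).continuous.aestronglyMeasurable.mul
    (((hδi i).mul (hδi j)).mul (hδi k))) (ae_of_all _ fun z => ?_)
  set a : EuclideanSpace ℝ d := v (x + z) - v x with ha
  have h3 := norm_sub_pow_three_le (v (x + z)) (v x)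
  rw [← ha] at h3
  have hi := PiLp.norm_apply_le a i
  have hj := PiLp.norm_apply_le a j
  have hk := PiLp.norm_apply_le a k
  rw [norm_mul, norm_mul, norm_mul]
  calc ‖FunctionSpaces.Torus.partialDeriv k (M i j) z‖ * (‖a i‖ * ‖a j‖ * ‖a k‖)
      ≤ C * (‖a‖ * ‖a‖ * ‖a‖) := by
        refine mul_le_mul (hC z) ?_ (by positivity) hC0
        exact mul_le_mul (mul_le_mul hi hj (norm_nonneg _) (norm_nonneg _)) hk (norm_nonneg _)
          (mul_nonneg (norm_nonneg _) (norm_nonneg _))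
    _ = C * ‖a‖ ^ 3 := by ring
    _ ≤ C * (4 * (‖v (x + z)‖ ^ 3 + ‖v x‖ ^ 3)) := mul_le_mul_of_nonneg_left h3 hC0

/-- **Novack's matrix cubic identity, pointwise** (the "direct computation" of Novack 2024, §2
Step 2, (mess:one), on one space point): for a smooth, even, symmetric matrix kernel `M`, an `L³`
weakly divergence-free field `v` and every `x`,
`𝒟_M(v)(x) = −∑ᵢⱼₖ((vᵢvⱼvₖ)⋆∂ₖM^{ij})(x) + ∑ᵢⱼₖ vₖ(x)((vᵢvⱼ)⋆∂ₖM^{ij})(x) + 2∑ᵢⱼₖ vⱼ(x)((vᵢvₖ)⋆∂ₖM^{ij})(x) − 2∑ᵢⱼₖ vⱼ(x)vₖ(x)(vᵢ⋆∂ₖM^{ij})(x)`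
(the entrywise expansion `integral_partialDeriv_mul_increment₃` summed over `i j k`; the terms
`vᵢ(x)(vⱼvₖ)`, `vᵢ(x)vₖ(x)vⱼ` fold onto `vⱼ(x)(vᵢvₖ)`, `vⱼ(x)vₖ(x)vᵢ` by the symmetry of `M`, and
`∑ₖ vₖ ⋆ ∂ₖM^{ij} = 0` by weak divergence-freeness). [cite: Novack2024, Sect. 2 Step 2 (mess:one)] -/
theorem matKernelFlux_eq_sum (hM : ∀ i j, FunctionSpaces.Torus.IsSmooth (M i j))
    (hMev : ∀ i j z, M i j (-z) = M i j z) (hMsymm : ∀ i j, M i j = M j i)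
    (hv : MemLp v 3 volume) (hdiv : FunctionSpaces.Torus.IsWeaklyDivFree v) (x : UnitAddTorus d) :
    matKernelFlux M v x =
      -(∑ i, ∑ j, ∑ k, ((fun y => v y i * v y j * v y k) ⋆
          FunctionSpaces.Torus.partialDeriv k (M i j)) x) +
        (∑ i, ∑ j, ∑ k, v x k * ((fun y => v y i * v y j) ⋆
          FunctionSpaces.Torus.partialDeriv k (M i j)) x) +
        2 * (∑ i, ∑ j, ∑ k, v x j * ((fun y => v y i * v y k) ⋆
          FunctionSpaces.Torus.partialDeriv k (M i j)) x) -
        2 * ∑ i, ∑ j, ∑ k, v x j * v x k * ((fun y => v y i) ⋆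
          FunctionSpaces.Torus.partialDeriv k (M i j)) x := by
  obtain ⟨-, -, I1⟩ := MemLp.integrable_norm_pow_three_and_sq hv
  rw [matKernelFlux, integral_finsetSum _ fun i _ => integrable_finsetSum _ fun j _ =>
    integrable_finsetSum _ fun k _ => integrable_matKernelFlux_entry hM hv x i j k]
  simp_rw [integral_finsetSum _ fun j _ => integrable_finsetSum _ fun k _ =>
    integrable_matKernelFlux_entry hM hv x _ j k,
    integral_finsetSum _ fun k _ => integrable_matKernelFlux_entry hM hv x _ _ k,
    integral_partialDeriv_mul_increment₃ (hM _ _) (hMev _ _) hv]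
  simp only [Finset.sum_add_distrib, Finset.sum_sub_distrib, Finset.sum_neg_distrib]
  -- the two symmetric pairs
  have hT4 : ∑ i, ∑ j, ∑ k, v x i * ((fun y => v y j * v y k) ⋆
      FunctionSpaces.Torus.partialDeriv k (M i j)) x =
      ∑ i, ∑ j, ∑ k, v x j * ((fun y => v y i * v y k) ⋆
        FunctionSpaces.Torus.partialDeriv k (M i j)) x := by
    rw [Finset.sum_comm]
    refine Finset.sum_congr rfl fun i _ => Finset.sum_congr rfl fun j _ =>
      Finset.sum_congr rfl fun k _ => ?_
    rw [hMsymm j i]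
  have hT6 : ∑ i, ∑ j, ∑ k, v x i * v x k * ((fun y => v y j) ⋆
      FunctionSpaces.Torus.partialDeriv k (M i j)) x =
      ∑ i, ∑ j, ∑ k, v x j * v x k * ((fun y => v y i) ⋆
        FunctionSpaces.Torus.partialDeriv k (M i j)) x := by
    rw [Finset.sum_comm]
    refine Finset.sum_congr rfl fun i _ => Finset.sum_congr rfl fun j _ =>
      Finset.sum_congr rfl fun k _ => ?_
    rw [hMsymm j i]
  -- the divergence-free term
  have hT7 : ∑ i, ∑ j, ∑ k, v x i * v x j * ((fun y => v y k) ⋆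
      FunctionSpaces.Torus.partialDeriv k (M i j)) x = 0 := by
    refine Finset.sum_eq_zero fun i _ => Finset.sum_eq_zero fun j _ => ?_
    rw [← Finset.mul_sum, sum_convolution_partialDeriv_eq_zero I1 hdiv (hM i j) x, mul_zero]
  rw [hT4, hT6, hT7]
  ring

end Pointwise

/-! ## Calculus of the matrix objects -/

section MatrixCalculus

variable {M : d → d → UnitAddTorus d → ℝ} {v : UnitAddTorus d → EuclideanSpace ℝ d}
  {χ : UnitAddTorus d → ℝ}

omit [Fintype d] [DecidableEq d] in
/-- Reindexing a triple sum: swap the two inner indices. [folklore] -/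
theorem triple_sum_swap_inner [Fintype d] (f : d → d → d → ℝ) :
    ∑ i, ∑ j, ∑ k, f i j k = ∑ i, ∑ k, ∑ j, f i j k :=
  Finset.sum_congr rfl fun _ _ => Finset.sum_comm

omit [Fintype d] [DecidableEq d] in
/-- Reindexing a triple sum: bring the outermost index innermost. [folklore] -/
theorem triple_sum_rotate_right [Fintype d] (f : d → d → d → ℝ) :
    ∑ i, ∑ j, ∑ k, f i j k = ∑ j, ∑ k, ∑ i, f i j k :=
  Finset.sum_comm.trans (Finset.sum_congr rfl fun _ _ => Finset.sum_comm)

omit [DecidableEq d] in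
/-- Finite double sums of mollifications of integrable functions by smooth kernels are smooth. [folklore] -/
theorem isSmooth_sum_sum_convolution {g : d → d → UnitAddTorus d → ℝ}
    (hg : ∀ i j, Integrable (g i j) volume) (hM : ∀ i j, FunctionSpaces.Torus.IsSmooth (M i j)) :
    FunctionSpaces.Torus.IsSmooth (fun y => ∑ i, ∑ j, (g i j ⋆ M i j) y) := by
  have hl : FunctionSpaces.Torus.lift (fun y => ∑ i, ∑ j, (g i j ⋆ M i j) y) =
      fun w => ∑ i, ∑ j, FunctionSpaces.Torus.lift (g i j ⋆ M i j) w := rfl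
  unfold FunctionSpaces.Torus.IsSmooth
  rw [hl]
  exact ContDiff.sum fun i _ => ContDiff.sum fun j _ =>
    FunctionSpaces.Torus.isSmooth_convolution (hg i j) (hM i j)

/-- Partial derivatives of double sums of mollifications: `∂ₖ ∑ᵢⱼ (gᵢⱼ ⋆ M i j) = ∑ᵢⱼ (gᵢⱼ ⋆ ∂ₖM i j)`
(`Torus.partialDeriv_convolution` termwise). [folklore] -/
theorem partialDeriv_sum_sum_convolution {g : d → d → UnitAddTorus d → ℝ}
    (hg : ∀ i j, Integrable (g i j) volume) (hM : ∀ i j, FunctionSpaces.Torus.IsSmooth (M i j))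
    (k : d) (x : UnitAddTorus d) :
    FunctionSpaces.Torus.partialDeriv k (fun y => ∑ i, ∑ j, (g i j ⋆ M i j) y) x =
      ∑ i, ∑ j, (g i j ⋆ FunctionSpaces.Torus.partialDeriv k (M i j)) x := by
  have hs : ∀ i j, FunctionSpaces.Torus.IsSmooth (g i j ⋆ M i j) := fun i j =>
    FunctionSpaces.Torus.isSmooth_convolution (hg i j) (hM i j)
  have hrow : ∀ i, FunctionSpaces.Torus.IsSmooth (fun y => ∑ j, (g i j ⋆ M i j) y) := by
    intro i
    have hl : FunctionSpaces.Torus.lift (fun y => ∑ j, (g i j ⋆ M i j) y) =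
        fun w => ∑ j, FunctionSpaces.Torus.lift (g i j ⋆ M i j) w := rfl
    unfold FunctionSpaces.Torus.IsSmooth
    rw [hl]
    exact ContDiff.sum fun j _ => hs i j
  rw [FunctionSpaces.Torus.partialDeriv_finset_sum _ (fun i _ => (hrow i).isContDiff (by simp))]
  refine Finset.sum_congr rfl fun i _ => ?_
  rw [FunctionSpaces.Torus.partialDeriv_finset_sum _ (fun j _ => (hs i j).isContDiff (by simp))]
  refine Finset.sum_congr rfl fun j _ => ?_
  exact FunctionSpaces.Torus.partialDeriv_convolution (hg i j) (hM i j) k x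

omit [DecidableEq d] in
/-- The matrix mollification of an integrable field by a smooth matrix kernel is smooth
(componentwise finite sums of smooth mollifications). Private copy of the lemma of the same name
in the sibling `NovackMatrixKernelTestFieldProofs` (not imported here). [folklore] -/
private theorem matConv_isSmooth (hM : ∀ i j, FunctionSpaces.Torus.IsSmooth (M i j))
    (hv : Integrable v volume) : FunctionSpaces.Torus.IsSmooth (matConv v M) := by
  have hvj : ∀ j, Integrable (fun y => v y j) volume := fun j => hv.eval_piLp j
  have hVs : ∀ i, FunctionSpaces.Torus.IsSmooth fun y => matConv v M y i := fun i => by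
    have hl : FunctionSpaces.Torus.lift (fun y => matConv v M y i) =
        fun w => ∑ j, FunctionSpaces.Torus.lift ((fun z => v z j) ⋆ M i j) w := rfl
    unfold FunctionSpaces.Torus.IsSmooth
    rw [hl]
    exact ContDiff.sum fun j _ => FunctionSpaces.Torus.isSmooth_convolution (hvj j) (hM i j)
  rw [FunctionSpaces.Torus.IsSmooth, contDiff_euclidean]
  exact fun i => hVs i

omit [DecidableEq d] in
/-- The symmetric matrix field of an integrable field, a smooth matrix kernel and a smooth cut-off
is smooth. Private copy of the lemma of the same name in the sibling
`NovackMatrixKernelTestFieldProofs` (not imported here). [folklore] -/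
private theorem matSymmTestField_isSmooth (hM : ∀ i j, FunctionSpaces.Torus.IsSmooth (M i j))
    (hχ : FunctionSpaces.Torus.IsSmooth χ) (hv : Integrable v volume) :
    FunctionSpaces.Torus.IsSmooth (matSymmTestField M χ v) :=
  (hχ.smul' (matConv_isSmooth hM hv)).add (matConv_isSmooth hM (hχ.integrable_smul hv))

omit [DecidableEq d] in
/-- The quadratic matrix average of an `L³` field is smooth. [folklore] -/
theorem isSmooth_matConvSq (hM : ∀ i j, FunctionSpaces.Torus.IsSmooth (M i j))
    (hv : MemLp v 3 volume) : FunctionSpaces.Torus.IsSmooth (matConvSq v M) := by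
  obtain ⟨-, I2, -⟩ := MemLp.integrable_norm_pow_three_and_sq hv
  exact isSmooth_sum_sum_convolution (fun i j => integrable_apply_mul_apply hv.1 I2 i j) hM

/-- The partial derivatives of the quadratic matrix average:
`∂ₖ(|v_M|²) = ∑ᵢⱼ ((vᵢvⱼ) ⋆ ∂ₖM i j)`. [folklore] -/
theorem partialDeriv_matConvSq (hM : ∀ i j, FunctionSpaces.Torus.IsSmooth (M i j))
    (hv : MemLp v 3 volume) (k : d) (x : UnitAddTorus d) :
    FunctionSpaces.Torus.partialDeriv k (matConvSq v M) x =
      ∑ i, ∑ j, ((fun y => v y i * v y j) ⋆ FunctionSpaces.Torus.partialDeriv k (M i j)) x := by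
  obtain ⟨-, I2, -⟩ := MemLp.integrable_norm_pow_three_and_sq hv
  exact partialDeriv_sum_sum_convolution (fun i j => integrable_apply_mul_apply hv.1 I2 i j) hM k x

omit [DecidableEq d] in
/-- The cubic matrix average of an `L³` field is smooth. [folklore] -/
theorem isSmooth_matConvCube (hM : ∀ i j, FunctionSpaces.Torus.IsSmooth (M i j))
    (hv : MemLp v 3 volume) : FunctionSpaces.Torus.IsSmooth (matConvCube v M) := by
  have hVs : ∀ k, FunctionSpaces.Torus.IsSmooth fun y => matConvCube v M y k := fun k => by
    have hfun : (fun y => matConvCube v M y k) =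
        fun y => ∑ i, ∑ j, ((fun z => v z i * v z j * v z k) ⋆ M i j) y := by
      funext y
      rfl
    rw [hfun]
    exact isSmooth_sum_sum_convolution (fun i j => integrable_apply_mul_apply_mul_apply hv i j k) hM
  rw [FunctionSpaces.Torus.IsSmooth, contDiff_euclidean]
  exact fun k => hVs k

/-- The divergence of the cubic matrix average:
`div (u|u_M|²) = ∑ₖ ∑ᵢⱼ ((vᵢvⱼvₖ) ⋆ ∂ₖM i j)`. [folklore] -/
theorem divergence_matConvCube (hM : ∀ i j, FunctionSpaces.Torus.IsSmooth (M i j))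
    (hv : MemLp v 3 volume) (x : UnitAddTorus d) :
    FunctionSpaces.Torus.divergence (matConvCube v M) x =
      ∑ k, ∑ i, ∑ j, ((fun y => v y i * v y j * v y k) ⋆
        FunctionSpaces.Torus.partialDeriv k (M i j)) x := by
  unfold FunctionSpaces.Torus.divergence
  refine Finset.sum_congr rfl fun k _ => ?_
  have hfun : (fun y => matConvCube v M y k) =
      fun y => ∑ i, ∑ j, ((fun z => v z i * v z j * v z k) ⋆ M i j) y := by
    funext y
    rfl
  rw [hfun, partialDeriv_sum_sum_convolution
    (fun i j => integrable_apply_mul_apply_mul_apply hv i j k) hM k x]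

end MatrixCalculus

/-! ## The cubic identity on one time slice -/

section Slice

variable {M : d → d → UnitAddTorus d → ℝ} {v : UnitAddTorus d → EuclideanSpace ℝ d}
  {χ : UnitAddTorus d → ℝ}

/-- **Novack's matrix cubic identity on a time slice** (Novack 2024, §2 Step 2, (mess:one), first
equality, one time slice, tested form): for a smooth, even, symmetric matrix kernel `M`, an `L³`
weakly divergence-free field `v` and a smooth cut-off `χ`,
`∫ 𝒟_M(v) χ = ∫⟪(v|v_M|²), ∇χ⟫ − ∫(|v_M|²)⟪v,∇χ⟫ + 2∫⟪v, v_M⟫⟪v,∇χ⟫ − 2∫⟪v,(v·∇)Φ_M⟫`,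
`Φ_M = χ v_M + (χv)_M` (the pointwise identity `matKernelFlux_eq_sum` integrated against `χ`:
integration by parts for the first term, weak divergence-freeness against `(|v_M|²)χ` for the
second, the odd adjointness `∫ f (g ⋆ ∂ₖM) = -∫ (f ⋆ ∂ₖM) g` for the third, and the coordinate
expansion of `⟪v,(v·∇)Φ_M⟫`). [cite: Novack2024, Sect. 2 Step 2 (mess:one)] -/
theorem integral_matKernelFlux_mul_slice (hM : ∀ i j, FunctionSpaces.Torus.IsSmooth (M i j))
    (hMev : ∀ i j z, M i j (-z) = M i j z) (hMsymm : ∀ i j, M i j = M j i)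
    (hv : MemLp v 3 volume) (hdiv : FunctionSpaces.Torus.IsWeaklyDivFree v)
    (hχ : FunctionSpaces.Torus.IsSmooth χ) :
    ∫ x, matKernelFlux M v x * χ x =
      (∫ x, ⟪matConvCube v M x, FunctionSpaces.Torus.gradient χ x⟫) -
      (∫ x, matConvSq v M x * ⟪v x, FunctionSpaces.Torus.gradient χ x⟫) +
      2 * (∫ x, ⟪v x, matConv v M x⟫ * ⟪v x, FunctionSpaces.Torus.gradient χ x⟫) -
      2 * ∫ x, ⟪v x, FunctionSpaces.Torus.convect v (matSymmTestField M χ v) x⟫ := by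
  obtain ⟨I3, I2, I1⟩ := MemLp.integrable_norm_pow_three_and_sq hv
  have hχ1 : FunctionSpaces.Torus.IsContDiff 1 χ := hχ.isContDiff (by simp)
  have hvi : ∀ i, Integrable (fun y => v y i) volume := fun i => I1.eval_piLp i
  have hvv : ∀ i j, Integrable (fun y => v y i * v y j) volume :=
    fun i j => integrable_apply_mul_apply hv.1 I2 i j
  have hvvv : ∀ i j k, Integrable (fun y => v y i * v y j * v y k) volume :=
    fun i j k => integrable_apply_mul_apply_mul_apply hv i j k
  have hχvi : ∀ i, Integrable (fun y => χ y * v y i) volume := fun i => hχ.integrable_smul (hvi i)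
  have hMk : ∀ i j k, FunctionSpaces.Torus.IsSmooth (FunctionSpaces.Torus.partialDeriv k (M i j)) :=
    fun i j k => (hM i j).partialDeriv k
  have hM1 : ∀ i j, FunctionSpaces.Torus.IsContDiff 1 (M i j) := fun i j =>
    (hM i j).isContDiff (by simp)
  -- continuity of the mollified products
  have c1 : ∀ i j k l, Continuous ((fun y => v y l) ⋆ FunctionSpaces.Torus.partialDeriv k (M i j)) :=
    fun i j k l => (FunctionSpaces.Torus.isSmooth_convolution (hvi l) (hMk i j k)).continuous
  have c2 : ∀ i j k l m, Continuous
      ((fun y => v y l * v y m) ⋆ FunctionSpaces.Torus.partialDeriv k (M i j)) :=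
    fun i j k l m => (FunctionSpaces.Torus.isSmooth_convolution (hvv l m) (hMk i j k)).continuous
  have c3 : ∀ i j k, Continuous
      ((fun y => v y i * v y j * v y k) ⋆ FunctionSpaces.Torus.partialDeriv k (M i j)) :=
    fun i j k => (FunctionSpaces.Torus.isSmooth_convolution (hvvv i j k) (hMk i j k)).continuous
  have cχ : ∀ i j k l, Continuous
      ((fun y => χ y * v y l) ⋆ FunctionSpaces.Torus.partialDeriv k (M i j)) :=
    fun i j k l => (FunctionSpaces.Torus.isSmooth_convolution (hχvi l) (hMk i j k)).continuous
  -- the smooth fields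
  have hV : FunctionSpaces.Torus.IsSmooth (matConvCube v M) := isSmooth_matConvCube hM hv
  have hS : FunctionSpaces.Torus.IsSmooth (matConvSq v M) := isSmooth_matConvSq hM hv
  have hΦ : FunctionSpaces.Torus.IsSmooth (matSymmTestField M χ v) := matSymmTestField_isSmooth hM hχ I1
  have hmc : Continuous (matConv v M) := continuous_matConv hM I1
  -- the four `x`-integrands of the pointwise identity multiplied by `χ`
  set A : UnitAddTorus d → ℝ := fun x => χ x * ∑ i, ∑ j, ∑ k,
    ((fun y => v y i * v y j * v y k) ⋆ FunctionSpaces.Torus.partialDeriv k (M i j)) x with hA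
  set B : UnitAddTorus d → ℝ := fun x => χ x * ∑ i, ∑ j, ∑ k,
    v x k * ((fun y => v y i * v y j) ⋆ FunctionSpaces.Torus.partialDeriv k (M i j)) x with hB
  set P : UnitAddTorus d → ℝ := fun x => χ x * ∑ i, ∑ j, ∑ k,
    v x j * ((fun y => v y i * v y k) ⋆ FunctionSpaces.Torus.partialDeriv k (M i j)) x with hP
  set Q : UnitAddTorus d → ℝ := fun x => χ x * ∑ i, ∑ j, ∑ k,
    v x j * v x k * ((fun y => v y i) ⋆ FunctionSpaces.Torus.partialDeriv k (M i j)) x with hQ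
  obtain ⟨Cχ, hCχ⟩ := FunctionSpaces.Torus.exists_forall_norm_le_of_continuous hχ.continuous
  have iA : Integrable A volume := by
    have hc : Continuous fun x => ∑ i, ∑ j, ∑ k,
        ((fun y => v y i * v y j * v y k) ⋆ FunctionSpaces.Torus.partialDeriv k (M i j)) x :=
      continuous_finsetSum _ fun i _ => continuous_finsetSum _ fun j _ =>
        continuous_finsetSum _ fun k _ => c3 i j k
    exact (hχ.continuous.mul hc).integrable_unitAddTorus
  have iB : Integrable B volume := by
    have h0 : Integrable (fun x => ∑ i, ∑ j, ∑ k,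
        v x k * ((fun y => v y i * v y j) ⋆ FunctionSpaces.Torus.partialDeriv k (M i j)) x) volume :=
      integrable_finsetSum _ fun i _ => integrable_finsetSum _ fun j _ =>
        integrable_finsetSum _ fun k _ => integrable_mul_continuous (hvi k) (c2 i j k i j)
    exact h0.bdd_mul hχ.continuous.aestronglyMeasurable (ae_of_all _ hCχ)
  have iP : Integrable P volume := by
    have h0 : Integrable (fun x => ∑ i, ∑ j, ∑ k,
        v x j * ((fun y => v y i * v y k) ⋆ FunctionSpaces.Torus.partialDeriv k (M i j)) x) volume :=
      integrable_finsetSum _ fun i _ => integrable_finsetSum _ fun j _ =>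
        integrable_finsetSum _ fun k _ => integrable_mul_continuous (hvi j) (c2 i j k i k)
    exact h0.bdd_mul hχ.continuous.aestronglyMeasurable (ae_of_all _ hCχ)
  have iQ : Integrable Q volume := by
    have h0 : Integrable (fun x => ∑ i, ∑ j, ∑ k,
        v x j * v x k * ((fun y => v y i) ⋆ FunctionSpaces.Torus.partialDeriv k (M i j)) x) volume :=
      integrable_finsetSum _ fun i _ => integrable_finsetSum _ fun j _ =>
        integrable_finsetSum _ fun k _ => integrable_mul_continuous (hvv j k) (c1 i j k i)
    exact h0.bdd_mul hχ.continuous.aestronglyMeasurable (ae_of_all _ hCχ)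
  -- Step 1: the pointwise identity, multiplied by `χ`, and splitting of the integral
  have hpt : ∀ x, matKernelFlux M v x * χ x = -A x + B x + 2 * P x - 2 * Q x := by
    intro x
    rw [matKernelFlux_eq_sum hM hMev hMsymm hv hdiv x]
    simp only [hA, hB, hP, hQ]
    ring
  have hAn : Integrable (fun x => -A x) volume := iA.neg
  have h1 : Integrable (fun x => -A x + B x) volume := hAn.add iB
  have h2 : Integrable (fun x => -A x + B x + 2 * P x) volume := h1.add (iP.const_mul 2)
  rw [integral_congr_ae (ae_of_all _ hpt), integral_sub h2 (iQ.const_mul 2),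
    integral_add h1 (iP.const_mul 2), integral_add hAn iB, integral_neg, integral_const_mul,
    integral_const_mul]
  -- Step 2: `∫ A = -∫ ⟪(v|v_M|²), ∇χ⟫` (integration by parts)
  have eA : ∫ x, A x = -∫ x, ⟪matConvCube v M x, FunctionSpaces.Torus.gradient χ x⟫ := by
    rw [FunctionSpaces.Torus.integral_inner_gradient_eq_neg_integral_mul_divergence_holds hV hχ,
      neg_neg]
    refine integral_congr_ae (ae_of_all _ fun x => ?_)
    simp only [hA]
    rw [divergence_matConvCube hM hv x, Finset.sum_comm_cycle]
  -- Step 3: `∫ B = -∫ (|v_M|²) ⟪v, ∇χ⟫` (weak divergence-freeness against `(|v_M|²) χ`)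
  have hBpt : ∀ x, B x = χ x * ⟪v x, FunctionSpaces.Torus.gradient (matConvSq v M) x⟫ := by
    intro x
    simp only [hB]
    rw [Finset.sum_comm_cycle]
    congr 1
    rw [inner_eq_sum_mul]
    refine Finset.sum_congr rfl fun k _ => ?_
    rw [FunctionSpaces.Torus.gradient_apply (hS.isContDiff (by simp)) x k,
      partialDeriv_matConvSq hM hv k x, Finset.mul_sum]
    refine Finset.sum_congr rfl fun i _ => ?_
    rw [Finset.mul_sum]
  obtain ⟨CS, hCS⟩ := FunctionSpaces.Torus.exists_forall_norm_le_of_continuous hS.continuous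
  have iSg : Integrable (fun x => matConvSq v M x * ⟪v x, FunctionSpaces.Torus.gradient χ x⟫) volume :=
    (integrable_inner_continuous I1 hχ.gradient.continuous).bdd_mul hS.continuous.aestronglyMeasurable
      (ae_of_all _ hCS)
  have eB : ∫ x, B x = -∫ x, matConvSq v M x * ⟪v x, FunctionSpaces.Torus.gradient χ x⟫ := by
    have h0 := hdiv (fun y => matConvSq v M y * χ y) (hS.smul' hχ)
    have hgrad : ∀ x, ⟪v x, FunctionSpaces.Torus.gradient (fun y => matConvSq v M y * χ y) x⟫ =
        matConvSq v M x * ⟪v x, FunctionSpaces.Torus.gradient χ x⟫ + B x := by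
      intro x
      rw [gradient_mul_of_isContDiff (hS.isContDiff (by simp)) hχ1, inner_add_right,
        real_inner_smul_right, real_inner_smul_right, hBpt x]
    simp_rw [hgrad] at h0
    rw [integral_add iSg iB] at h0
    linarith
  -- Step 4: `∫ P = -∫ G₃` (odd adjointness), `G₃ = ∑ᵢⱼₖ ((χvⱼ) ⋆ ∂ₖM i j) vᵢ vₖ`
  set G3 : UnitAddTorus d → ℝ := fun y => ∑ i, ∑ j, ∑ k,
    ((fun z => χ z * v z j) ⋆ FunctionSpaces.Torus.partialDeriv k (M i j)) y * (v y i * v y k)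
    with hG3
  have iPijk : ∀ i j k, Integrable (fun x => χ x * v x j *
      ((fun y => v y i * v y k) ⋆ FunctionSpaces.Torus.partialDeriv k (M i j)) x) volume :=
    fun i j k => integrable_mul_continuous (hχvi j) (c2 i j k i k)
  have iG3ijk : ∀ i j k, Integrable (fun y =>
      ((fun z => χ z * v z j) ⋆ FunctionSpaces.Torus.partialDeriv k (M i j)) y *
        (v y i * v y k)) volume := by
    intro i j k
    simpa only [mul_comm] using integrable_mul_continuous (hvv i k) (cχ i j k j)
  have iG3 : Integrable G3 volume :=
    integrable_finsetSum _ fun i _ => integrable_finsetSum _ fun j _ =>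
      integrable_finsetSum _ fun k _ => iG3ijk i j k
  have hodd : ∀ i j k, ∫ x, χ x * v x j *
      ((fun y => v y i * v y k) ⋆ FunctionSpaces.Torus.partialDeriv k (M i j)) x =
      -∫ y, ((fun z => χ z * v z j) ⋆ FunctionSpaces.Torus.partialDeriv k (M i j)) y *
        (v y i * v y k) :=
    fun i j k => integral_mul_convolution_odd (hχvi j) (hvv i k) (hMk i j k).continuous
      (partialDeriv_neg_of_even (hM1 i j) (hMev i j) k)
  have hPsum : ∀ x, P x = ∑ i, ∑ j, ∑ k, χ x * v x j *
      ((fun y => v y i * v y k) ⋆ FunctionSpaces.Torus.partialDeriv k (M i j)) x := by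
    intro x
    simp only [hP, Finset.mul_sum]
    exact Finset.sum_congr rfl fun i _ => Finset.sum_congr rfl fun j _ =>
      Finset.sum_congr rfl fun k _ => by ring
  have eP : ∫ x, P x = -∫ y, G3 y := by
    rw [integral_congr_ae (ae_of_all _ hPsum)]
    simp only [hG3]
    rw [integral_finsetSum _ fun i _ => integrable_finsetSum _ fun j _ =>
        integrable_finsetSum _ fun k _ => iPijk i j k,
      integral_finsetSum _ fun i _ => integrable_finsetSum _ fun j _ =>
        integrable_finsetSum _ fun k _ => iG3ijk i j k,
      ← Finset.sum_neg_distrib]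
    refine Finset.sum_congr rfl fun i _ => ?_
    rw [integral_finsetSum _ fun j _ => integrable_finsetSum _ fun k _ => iPijk i j k,
      integral_finsetSum _ fun j _ => integrable_finsetSum _ fun k _ => iG3ijk i j k,
      ← Finset.sum_neg_distrib]
    refine Finset.sum_congr rfl fun j _ => ?_
    rw [integral_finsetSum _ fun k _ => iPijk i j k, integral_finsetSum _ fun k _ => iG3ijk i j k,
      ← Finset.sum_neg_distrib]
    exact Finset.sum_congr rfl fun k _ => hodd i j k
  -- Step 5: the convective pairing in coordinates
  have iE : Integrable (fun x => ⟪v x, matConv v M x⟫ * ⟪v x, FunctionSpaces.Torus.gradient χ x⟫)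
      volume := by
    obtain ⟨C₁, hC₁⟩ := FunctionSpaces.Torus.exists_forall_norm_le_of_continuous hmc
    obtain ⟨C₂, hC₂⟩ := FunctionSpaces.Torus.exists_forall_norm_le_of_continuous hχ.gradient.continuous
    refine (I2.const_mul (C₁ * C₂)).mono'
      ((hv.1.inner hmc.aestronglyMeasurable).mul
        (hv.1.inner hχ.gradient.continuous.aestronglyMeasurable)) (ae_of_all _ fun x => ?_)
    rw [norm_mul]
    have h1 : ‖⟪v x, matConv v M x⟫‖ ≤ ‖v x‖ * C₁ :=
      (norm_inner_le_norm _ _).trans (mul_le_mul_of_nonneg_left (hC₁ x) (norm_nonneg _))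
    have h2 : ‖⟪v x, FunctionSpaces.Torus.gradient χ x⟫‖ ≤ ‖v x‖ * C₂ :=
      (norm_inner_le_norm _ _).trans (mul_le_mul_of_nonneg_left (hC₂ x) (norm_nonneg _))
    have hC₁0 : 0 ≤ C₁ := (norm_nonneg _).trans (hC₁ x)
    calc ‖⟪v x, matConv v M x⟫‖ * ‖⟪v x, FunctionSpaces.Torus.gradient χ x⟫‖
        ≤ (‖v x‖ * C₁) * (‖v x‖ * C₂) := mul_le_mul h1 h2 (norm_nonneg _) (by positivity)
      _ = C₁ * C₂ * ‖v x‖ ^ 2 := by ring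
  have hconv : ∀ x, ⟪v x, FunctionSpaces.Torus.convect v (matSymmTestField M χ v) x⟫ =
      ⟪v x, matConv v M x⟫ * ⟪v x, FunctionSpaces.Torus.gradient χ x⟫ + Q x + G3 x := by
    intro x
    rw [inner_convect_eq_sum (hΦ.isContDiff (by simp)) (v x) v x]
    simp only [partialDeriv_matSymmTestField hM hχ I1, mul_add, Finset.mul_sum,
      Finset.sum_add_distrib]
    have e1 : ∑ a, ∑ b, ∑ c, v x a * (v x b * (FunctionSpaces.Torus.partialDeriv b χ x *
        ((fun z => v z c) ⋆ M a c) x)) =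
        ⟪v x, matConv v M x⟫ * ⟪v x, FunctionSpaces.Torus.gradient χ x⟫ := by
      rw [inner_eq_sum_mul (v x) (matConv v M x),
        inner_eq_sum_mul (v x) (FunctionSpaces.Torus.gradient χ x), Finset.sum_mul_sum]
      refine Finset.sum_congr rfl fun a _ => Finset.sum_congr rfl fun b _ => ?_
      rw [matConv_apply, FunctionSpaces.Torus.gradient_apply hχ1 x b, Finset.mul_sum,
        Finset.sum_mul]
      exact Finset.sum_congr rfl fun c _ => by ring
    have e2 : ∑ a, ∑ b, ∑ c, v x a * (v x b * (χ x *
        ((fun z => v z c) ⋆ FunctionSpaces.Torus.partialDeriv b (M a c)) x)) = Q x := by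
      simp only [hQ]
      rw [triple_sum_rotate_right (fun i j k => v x j * v x k *
        ((fun y => v y i) ⋆ FunctionSpaces.Torus.partialDeriv k (M i j)) x)]
      simp only [Finset.mul_sum]
      refine Finset.sum_congr rfl fun a _ => Finset.sum_congr rfl fun b _ =>
        Finset.sum_congr rfl fun c _ => ?_
      rw [hMsymm c a]
      ring
    have e3 : ∑ a, ∑ b, ∑ c, v x a * (v x b *
        ((fun z => χ z * v z c) ⋆ FunctionSpaces.Torus.partialDeriv b (M a c)) x) = G3 x := by
      simp only [hG3]
      rw [triple_sum_swap_inner (fun i j k =>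
        ((fun z => χ z * v z j) ⋆ FunctionSpaces.Torus.partialDeriv k (M i j)) x * (v x i * v x k))]
      exact Finset.sum_congr rfl fun a _ => Finset.sum_congr rfl fun b _ =>
        Finset.sum_congr rfl fun c _ => by ring
    rw [e1, e2, e3]
  have iES : Integrable (fun x => ⟪v x, matConv v M x⟫ * ⟪v x, FunctionSpaces.Torus.gradient χ x⟫ +
      Q x) volume := iE.add iQ
  have econv : ∫ x, ⟪v x, FunctionSpaces.Torus.convect v (matSymmTestField M χ v) x⟫ =
      (∫ x, ⟪v x, matConv v M x⟫ * ⟪v x, FunctionSpaces.Torus.gradient χ x⟫) +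
        (∫ x, Q x) + ∫ x, G3 x := by
    rw [integral_congr_ae (ae_of_all _ hconv), integral_add iES iG3, integral_add iE iQ]
  rw [eA, eB, eP, econv]
  ring

end Slice

/-! ## Space–time bookkeeping: measurability, dominations, Fubini -/

section Bounds

variable {M : d → d → UnitAddTorus d → ℝ} {v : UnitAddTorus d → EuclideanSpace ℝ d}

omit [DecidableEq d] in
/-- `|wᵢ wⱼ| ≤ |w|²` for the coordinates of a Euclidean vector. [folklore] -/
theorem norm_apply_mul_apply_le (w : EuclideanSpace ℝ d) (i j : d) : ‖w i * w j‖ ≤ ‖w‖ ^ 2 := by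
  rw [norm_mul]
  have hi := PiLp.norm_apply_le w i
  have hj := PiLp.norm_apply_le w j
  calc ‖w i‖ * ‖w j‖ ≤ ‖w‖ * ‖w‖ := mul_le_mul hi hj (norm_nonneg _) (norm_nonneg _)
    _ = ‖w‖ ^ 2 := by ring

omit [DecidableEq d] in
/-- `|wᵢ wⱼ wₖ| ≤ |w|³` for the coordinates of a Euclidean vector. [folklore] -/
theorem norm_apply_mul_apply_mul_apply_le (w : EuclideanSpace ℝ d) (i j k : d) :
    ‖w i * w j * w k‖ ≤ ‖w‖ ^ 3 := by
  rw [norm_mul, norm_mul]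
  have hi := PiLp.norm_apply_le w i
  have hj := PiLp.norm_apply_le w j
  have hk := PiLp.norm_apply_le w k
  calc ‖w i‖ * ‖w j‖ * ‖w k‖ ≤ ‖w‖ * ‖w‖ * ‖w‖ :=
        mul_le_mul (mul_le_mul hi hj (norm_nonneg _) (norm_nonneg _)) hk (norm_nonneg _)
          (mul_nonneg (norm_nonneg _) (norm_nonneg _))
    _ = ‖w‖ ^ 3 := by ring

/-- Pointwise bound for the matrix mollification of an integrable field by a bounded matrix
kernel: `‖v_M(x)‖ ≤ (∑ᵢⱼ Cᵢⱼ) ∫‖v‖`. [folklore] -/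
theorem norm_matConv_le (hv : Integrable v volume) {C : d → d → ℝ}
    (hC : ∀ i j z, ‖M i j z‖ ≤ C i j) (x : UnitAddTorus d) :
    ‖matConv v M x‖ ≤ (∑ i, ∑ j, C i j) * ∫ y, ‖v y‖ := by
  have hvj : ∀ j, Integrable (fun y => v y j) volume := fun j => hv.eval_piLp j
  calc ‖matConv v M x‖ ≤ ∑ i, ‖matConv v M x i‖ := norm_le_sum_norm_apply _
    _ ≤ ∑ i, ∑ j, C i j * ∫ y, ‖v y‖ := Finset.sum_le_sum fun i _ => by
        rw [matConv_apply]
        refine (norm_sum_le _ _).trans (Finset.sum_le_sum fun j _ => ?_)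
        have hC0 : 0 ≤ C i j := (norm_nonneg _).trans (hC i j 0)
        refine (FunctionSpaces.Torus.norm_convolution_le (hvj j) (hC i j) x).trans ?_
        exact mul_le_mul_of_nonneg_left
          (integral_mono (hvj j).norm hv.norm fun y => PiLp.norm_apply_le (v y) j) hC0
    _ = (∑ i, ∑ j, C i j) * ∫ y, ‖v y‖ := by simp_rw [Finset.sum_mul]

omit [DecidableEq d] in
/-- Pointwise bound for the quadratic matrix average of an `L³` field:
`|(|v_M|²)(x)| ≤ (∑ᵢⱼ Cᵢⱼ) ∫‖v‖²`. [folklore] -/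
theorem norm_matConvSq_le (hv : MemLp v 3 volume) {C : d → d → ℝ}
    (hC : ∀ i j z, ‖M i j z‖ ≤ C i j) (x : UnitAddTorus d) :
    ‖matConvSq v M x‖ ≤ (∑ i, ∑ j, C i j) * ∫ y, ‖v y‖ ^ 2 := by
  obtain ⟨-, I2, -⟩ := MemLp.integrable_norm_pow_three_and_sq hv
  have hvv : ∀ i j, Integrable (fun y => v y i * v y j) volume :=
    fun i j => integrable_apply_mul_apply hv.1 I2 i j
  calc ‖matConvSq v M x‖ ≤ ∑ i, ‖∑ j, ((fun y => v y i * v y j) ⋆ M i j) x‖ := norm_sum_le _ _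
    _ ≤ ∑ i, ∑ j, C i j * ∫ y, ‖v y‖ ^ 2 := Finset.sum_le_sum fun i _ => by
        refine (norm_sum_le _ _).trans (Finset.sum_le_sum fun j _ => ?_)
        have hC0 : 0 ≤ C i j := (norm_nonneg _).trans (hC i j 0)
        refine (FunctionSpaces.Torus.norm_convolution_le (hvv i j) (hC i j) x).trans ?_
        exact mul_le_mul_of_nonneg_left
          (integral_mono (hvv i j).norm I2 fun y => norm_apply_mul_apply_le (v y) i j) hC0
    _ = (∑ i, ∑ j, C i j) * ∫ y, ‖v y‖ ^ 2 := by simp_rw [Finset.sum_mul]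

/-- Pointwise bound for the cubic matrix average of an `L³` field:
`‖(v|v_M|²)(x)‖ ≤ #d (∑ᵢⱼ Cᵢⱼ) ∫‖v‖³`. [folklore] -/
theorem norm_matConvCube_le (hv : MemLp v 3 volume) {C : d → d → ℝ}
    (hC : ∀ i j z, ‖M i j z‖ ≤ C i j) (x : UnitAddTorus d) :
    ‖matConvCube v M x‖ ≤ Fintype.card d * ((∑ i, ∑ j, C i j) * ∫ y, ‖v y‖ ^ 3) := by
  obtain ⟨I3, -, -⟩ := MemLp.integrable_norm_pow_three_and_sq hv
  have hvvv : ∀ i j k, Integrable (fun y => v y i * v y j * v y k) volume :=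
    fun i j k => integrable_apply_mul_apply_mul_apply hv i j k
  calc ‖matConvCube v M x‖ ≤ ∑ k, ‖matConvCube v M x k‖ := norm_le_sum_norm_apply _
    _ ≤ ∑ _k : d, (∑ i, ∑ j, C i j) * ∫ y, ‖v y‖ ^ 3 := Finset.sum_le_sum fun k _ => by
        rw [matConvCube_apply]
        calc ‖∑ i, ∑ j, ((fun y => v y i * v y j * v y k) ⋆ M i j) x‖
            ≤ ∑ i, ‖∑ j, ((fun y => v y i * v y j * v y k) ⋆ M i j) x‖ := norm_sum_le _ _
          _ ≤ ∑ i, ∑ j, C i j * ∫ y, ‖v y‖ ^ 3 := Finset.sum_le_sum fun i _ => by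
              refine (norm_sum_le _ _).trans (Finset.sum_le_sum fun j _ => ?_)
              have hC0 : 0 ≤ C i j := (norm_nonneg _).trans (hC i j 0)
              refine (FunctionSpaces.Torus.norm_convolution_le (hvvv i j k) (hC i j) x).trans ?_
              exact mul_le_mul_of_nonneg_left (integral_mono (hvvv i j k).norm I3 fun y =>
                norm_apply_mul_apply_mul_apply_le (v y) i j k) hC0
          _ = (∑ i, ∑ j, C i j) * ∫ y, ‖v y‖ ^ 3 := by simp_rw [Finset.sum_mul]
    _ = Fintype.card d * ((∑ i, ∑ j, C i j) * ∫ y, ‖v y‖ ^ 3) := by simp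

/-- Pointwise bound for the matrix flux through a smooth matrix kernel with entrywise bounded
gradient: `|𝒟_M(v)(x)| ≤ 4 (∑ᵢⱼₖ Cᵢⱼₖ) (∫|v|³ + |v(x)|³)` for `v ∈ L³`. [folklore] -/
theorem abs_matKernelFlux_le (hv : MemLp v 3 volume) {C : d → d → d → ℝ}
    (hC : ∀ i j k z, ‖FunctionSpaces.Torus.partialDeriv k (M i j) z‖ ≤ C i j k)
    (x : UnitAddTorus d) :
    |matKernelFlux M v x| ≤
      4 * (∑ i, ∑ j, ∑ k, C i j k) * ((∫ y, ‖v y‖ ^ 3) + ‖v x‖ ^ 3) := by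
  obtain ⟨I3, -, -⟩ := MemLp.integrable_norm_pow_three_and_sq hv
  have hC0 : ∀ i j k, 0 ≤ C i j k := fun i j k => (norm_nonneg _).trans (hC i j k 0)
  have hCt0 : 0 ≤ ∑ i, ∑ j, ∑ k, C i j k := Finset.sum_nonneg fun i _ =>
    Finset.sum_nonneg fun j _ => Finset.sum_nonneg fun k _ => hC0 i j k
  have hint : Integrable (fun z => 4 * (∑ i, ∑ j, ∑ k, C i j k) *
      (‖v (x + z)‖ ^ 3 + ‖v x‖ ^ 3)) volume :=
    ((I3.comp_add_left x).add (integrable_const _)).const_mul _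
  rw [matKernelFlux, ← Real.norm_eq_abs]
  refine (norm_integral_le_integral_norm _).trans ?_
  calc ∫ z, ‖∑ i, ∑ j, ∑ k, FunctionSpaces.Torus.partialDeriv k (M i j) z *
        ((v (x + z) - v x) i * (v (x + z) - v x) j * (v (x + z) - v x) k)‖
      ≤ ∫ z, 4 * (∑ i, ∑ j, ∑ k, C i j k) * (‖v (x + z)‖ ^ 3 + ‖v x‖ ^ 3) := by
        refine integral_mono_of_nonneg (ae_of_all _ fun z => norm_nonneg _) hint
          (ae_of_all _ fun z => ?_)
        dsimp only
        set a : EuclideanSpace ℝ d := v (x + z) - v x with ha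
        have h3 := norm_sub_pow_three_le (v (x + z)) (v x)
        rw [← ha] at h3
        have hterm : ∀ i j k, ‖FunctionSpaces.Torus.partialDeriv k (M i j) z * (a i * a j * a k)‖ ≤
            C i j k * ‖a‖ ^ 3 := fun i j k => by
          rw [norm_mul]
          exact mul_le_mul (hC i j k z) (norm_apply_mul_apply_mul_apply_le a i j k) (norm_nonneg _)
            (hC0 i j k)
        calc ‖∑ i, ∑ j, ∑ k, FunctionSpaces.Torus.partialDeriv k (M i j) z * (a i * a j * a k)‖
            ≤ ∑ i, ∑ j, ∑ k, C i j k * ‖a‖ ^ 3 := by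
              refine (norm_sum_le _ _).trans (Finset.sum_le_sum fun i _ => ?_)
              refine (norm_sum_le _ _).trans (Finset.sum_le_sum fun j _ => ?_)
              exact (norm_sum_le _ _).trans (Finset.sum_le_sum fun k _ => hterm i j k)
          _ = (∑ i, ∑ j, ∑ k, C i j k) * ‖a‖ ^ 3 := by simp_rw [Finset.sum_mul]
          _ ≤ (∑ i, ∑ j, ∑ k, C i j k) * (4 * (‖v (x + z)‖ ^ 3 + ‖v x‖ ^ 3)) :=
              mul_le_mul_of_nonneg_left h3 hCt0
          _ = 4 * (∑ i, ∑ j, ∑ k, C i j k) * (‖v (x + z)‖ ^ 3 + ‖v x‖ ^ 3) := by ring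
    _ = 4 * (∑ i, ∑ j, ∑ k, C i j k) * ((∫ y, ‖v y‖ ^ 3) + ‖v x‖ ^ 3) := by
        rw [integral_const_mul, integral_add (I3.comp_add_left x) (integrable_const _),
          integral_add_left_eq_self (fun y => ‖v y‖ ^ 3) x, integral_const, smul_eq_mul]
        simp

end Bounds

section Measurability

variable {α : Type*} [MeasurableSpace α] {μ : Measure α} [SFinite μ]
  {M : d → d → UnitAddTorus d → ℝ} {u : α → UnitAddTorus d → EuclideanSpace ℝ d}

omit [DecidableEq d] in
/-- A map into `ℝ^d` whose coordinates are a.e.-strongly measurable is a.e.-strongly measurable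
(reassembly through the measurable map `WithLp.toLp`). [folklore] -/
theorem aestronglyMeasurable_euclidean_of_apply {β : Type*} [MeasurableSpace β] {ν : Measure β}
    {F : β → EuclideanSpace ℝ d} (hF : ∀ i, AEStronglyMeasurable (fun b => F b i) ν) :
    AEStronglyMeasurable F ν := by
  have hpi : AEMeasurable (fun b => fun i => F b i) ν :=
    aemeasurable_pi_lambda _ fun i => (hF i).aemeasurable
  have h : F = fun b => WithLp.toLp 2 (fun i => F b i) := rfl
  rw [h]
  exact ((WithLp.measurable_toLp 2 (d → ℝ)).comp_aemeasurable hpi).aestronglyMeasurable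

omit [DecidableEq d] in
/-- **Matrix-mollified fields are jointly measurable**: for `u` jointly measurable on `α × T^d`
and a continuous matrix kernel `M`, `(a, x) ↦ (u(a))_M(x)` is jointly measurable. [folklore] -/
theorem aestronglyMeasurable_uncurry_matConv
    (hm : AEStronglyMeasurable (uncurry u) (μ.prod volume)) (hM : ∀ i j, Continuous (M i j)) :
    AEStronglyMeasurable (uncurry fun a x => matConv (u a) M x) (μ.prod volume) := by
  refine aestronglyMeasurable_euclidean_of_apply fun i => ?_
  have h : (fun z : α × UnitAddTorus d => uncurry (fun a x => matConv (u a) M x) z i) =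
      fun z => ∑ j, ((fun y => u z.1 y j) ⋆ M i j) z.2 := by
    funext z
    rfl
  rw [h]
  exact Finset.aestronglyMeasurable_fun_sum _ fun j _ =>
    FunctionSpaces.Torus.aestronglyMeasurable_uncurry_convolution (ContinuousLinearMap.lsmul ℝ ℝ)
      (aestronglyMeasurable_uncurry_apply hm j) (hM i j)

omit [DecidableEq d] in
/-- The quadratic matrix average `(a, x) ↦ (|u(a)_M|²)(x)` is jointly measurable. [folklore] -/
theorem aestronglyMeasurable_uncurry_matConvSq
    (hm : AEStronglyMeasurable (uncurry u) (μ.prod volume)) (hM : ∀ i j, Continuous (M i j)) :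
    AEStronglyMeasurable (uncurry fun a x => matConvSq (u a) M x) (μ.prod volume) := by
  have h2 : ∀ i j, AEStronglyMeasurable (uncurry fun a y => u a y i * u a y j) (μ.prod volume) :=
    fun i j => (aestronglyMeasurable_uncurry_apply hm i).mul (aestronglyMeasurable_uncurry_apply hm j)
  have h : uncurry (fun a x => matConvSq (u a) M x) =
      fun z => ∑ i, ∑ j, ((fun y => u z.1 y i * u z.1 y j) ⋆ M i j) z.2 := rfl
  rw [h]
  exact Finset.aestronglyMeasurable_fun_sum _ fun i _ => Finset.aestronglyMeasurable_fun_sum _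
    fun j _ => FunctionSpaces.Torus.aestronglyMeasurable_uncurry_convolution
      (ContinuousLinearMap.lsmul ℝ ℝ) (h2 i j) (hM i j)

omit [DecidableEq d] in
/-- The cubic matrix average `(a, x) ↦ (u(a)|u(a)_M|²)(x)` is jointly measurable. [folklore] -/
theorem aestronglyMeasurable_uncurry_matConvCube
    (hm : AEStronglyMeasurable (uncurry u) (μ.prod volume)) (hM : ∀ i j, Continuous (M i j)) :
    AEStronglyMeasurable (uncurry fun a x => matConvCube (u a) M x) (μ.prod volume) := by
  have h3 : ∀ i j k, AEStronglyMeasurable (uncurry fun a y => u a y i * u a y j * u a y k)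
      (μ.prod volume) := fun i j k =>
    ((aestronglyMeasurable_uncurry_apply hm i).mul (aestronglyMeasurable_uncurry_apply hm j)).mul
      (aestronglyMeasurable_uncurry_apply hm k)
  refine aestronglyMeasurable_euclidean_of_apply fun k => ?_
  have h : (fun z : α × UnitAddTorus d => uncurry (fun a x => matConvCube (u a) M x) z k) =
      fun z => ∑ i, ∑ j, ((fun y => u z.1 y i * u z.1 y j * u z.1 y k) ⋆ M i j) z.2 := by
    funext z
    rfl
  rw [h]
  exact Finset.aestronglyMeasurable_fun_sum _ fun i _ => Finset.aestronglyMeasurable_fun_sum _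
    fun j _ => FunctionSpaces.Torus.aestronglyMeasurable_uncurry_convolution
      (ContinuousLinearMap.lsmul ℝ ℝ) (h3 i j k) (hM i j)

end Measurability

/-! ## Discharge of `Torus.integral_matKernelFlux_mul_eq` -/

section SpaceTime

/-- **Discharge of `Torus.integral_matKernelFlux_mul_eq`** (Novack 2024, §2 Step 2, (mess:one),
first equality, on `(0,T) × T^d`): the slice identity `integral_matKernelFlux_mul_slice` for a.e.
`t`, integrated in time; the four right-hand integrands are integrable on `(0,T) × T^d` by the
dominations `|⟪(u|u_M|²), ∇ψ⟫| ≲ ∫|u(t)|³`, `|(|u_M|²)⟪u,∇ψ⟫| ≲ (∫|u(t)|²)|u|`,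
`|⟪u, u_M⟫⟪u,∇ψ⟫| ≲ (∫|u(t)|)|u|²` (`integrable_slice_dominations`) and the flux itself by
`|𝒟_M(u)ψ| ≲ ∫|u(t)|³ + |u|³`, so that the time integral splits (Fubini). [cite: Novack2024, Sect. 2 Step 2 (mess:one)] -/
theorem integral_matKernelFlux_mul_eq_holds : integral_matKernelFlux_mul_eq (d := d) := by
  intro T u hmeas hu3 hdiv M hM hMev hMsymm ψ hψ
  set μ : Measure ℝ := volume.restrict (Ioo 0 T) with hμ
  set μT := μ.prod (volume : Measure (UnitAddTorus d)) with hμT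
  have hum : AEStronglyMeasurable (uncurry u) μT := aestronglyMeasurable_uncurry_prod hmeas
  have hslice3 : ∀ᵐ t ∂μ, MemLp (u t) 3 volume := ae_memLp_three_of_lintegral hum hu3
  have hMc : ∀ i j, Continuous (M i j) := fun i j => (hM i j).continuous
  -- test-field data
  obtain ⟨hψs, -, hgr, -⟩ := hψ.isSpaceTimeTest.isSmoothSpaceTimeOn_derived
  obtain ⟨⟨Cψ, hCψ0, hCψ⟩, hψm⟩ := hψs.bound_and_measurable T
  obtain ⟨⟨Cg, hCg0, hCg⟩, hgm⟩ := hgr.bound_and_measurable T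
  -- kernel data: entrywise bounds of `M` and of its first derivatives
  choose CM hCM using fun i j =>
    FunctionSpaces.Torus.exists_forall_norm_le_of_continuous (hMc i j)
  choose CM' hCM' using fun i j k =>
    FunctionSpaces.Torus.exists_forall_norm_le_of_continuous ((hM i j).partialDeriv k).continuous
  have hCM0 : ∀ i j, 0 ≤ CM i j := fun i j => (norm_nonneg _).trans (hCM i j 0)
  have hCM'0 : ∀ i j k, 0 ≤ CM' i j k := fun i j k => (norm_nonneg _).trans (hCM' i j k 0)
  set CK : ℝ := ∑ i, ∑ j, CM i j with hCK
  set CK' : ℝ := ∑ i, ∑ j, ∑ k, CM' i j k with hCK'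
  have hCK0 : 0 ≤ CK := Finset.sum_nonneg fun i _ => Finset.sum_nonneg fun j _ => hCM0 i j
  have hCK'0 : 0 ≤ CK' := Finset.sum_nonneg fun i _ => Finset.sum_nonneg fun j _ =>
    Finset.sum_nonneg fun k _ => hCM'0 i j k
  have hIoo : ∀ᵐ z ∂μT, z.1 ∈ Ioo 0 T := by
    rw [hμT, hμ, ← volume_restrict_Ioo_prod_univ]
    filter_upwards [ae_restrict_mem (measurableSet_Ioo.prod MeasurableSet.univ)] with z hz
    exact hz.1
  have hgood : ∀ᵐ z ∂μT, MemLp (u z.1) 3 volume :=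
    ae_prod_of_ae_left (hslice3.mono fun t ht => fun _ => ht)
  obtain ⟨D1, D2, D3⟩ := integrable_slice_dominations hum hu3
  have e3 : ∫⁻ t in Ioo 0 T, ∫⁻ x, ‖u t x‖ₑ ^ (3 : ℕ) = ∫⁻ z, ‖u z.1 z.2‖ₑ ^ (3 : ℕ) ∂μT :=
    lintegral_Ioo_lintegral_eq_lintegral_prod (hum.enorm.pow_const _)
  have I3 : Integrable (fun z : ℝ × UnitAddTorus d => ‖u z.1 z.2‖ ^ 3) μT :=
    integrable_norm_pow_three hum (by rwa [e3] at hu3)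
  -- measurability of the product integrands
  have mV : AEStronglyMeasurable (fun z : ℝ × UnitAddTorus d => matConvCube (u z.1) M z.2) μT :=
    aestronglyMeasurable_uncurry_matConvCube hum hMc
  have mS : AEStronglyMeasurable (fun z : ℝ × UnitAddTorus d => matConvSq (u z.1) M z.2) μT :=
    aestronglyMeasurable_uncurry_matConvSq hum hMc
  have mC : AEStronglyMeasurable (fun z : ℝ × UnitAddTorus d => matConv (u z.1) M z.2) μT :=
    aestronglyMeasurable_uncurry_matConv hum hMc
  have mA : AEStronglyMeasurable (fun z : ℝ × UnitAddTorus d =>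
      ⟪matConvCube (u z.1) M z.2, FunctionSpaces.Torus.gradient (ψ z.1) z.2⟫) μT := mV.inner hgm
  have mB : AEStronglyMeasurable (fun z : ℝ × UnitAddTorus d =>
      matConvSq (u z.1) M z.2 * ⟪u z.1 z.2, FunctionSpaces.Torus.gradient (ψ z.1) z.2⟫) μT :=
    mS.mul (hum.inner hgm)
  have mE : AEStronglyMeasurable (fun z : ℝ × UnitAddTorus d =>
      ⟪u z.1 z.2, matConv (u z.1) M z.2⟫ * ⟪u z.1 z.2, FunctionSpaces.Torus.gradient (ψ z.1) z.2⟫) μT :=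
    (hum.inner mC).mul (hum.inner hgm)
  have mK : AEStronglyMeasurable (fun z : ℝ × UnitAddTorus d =>
      matKernelFlux M (u z.1) z.2 * ψ z.1 z.2) μT := by
    have hδ : AEStronglyMeasurable (fun q : (ℝ × UnitAddTorus d) × UnitAddTorus d =>
        u q.1.1 (q.1.2 + q.2) - u q.1.1 q.1.2) (μT.prod volume) :=
      (aestronglyMeasurable_translate (ν := volume) hum measurable_id).sub hum.comp_fst
    have hδi : ∀ m, AEStronglyMeasurable (fun q : (ℝ × UnitAddTorus d) × UnitAddTorus d =>
        (u q.1.1 (q.1.2 + q.2) - u q.1.1 q.1.2) m) (μT.prod volume) := fun m =>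
      (EuclideanSpace.proj (𝕜 := ℝ) m).continuous.comp_aestronglyMeasurable hδ
    have hΨ : AEStronglyMeasurable (fun q : (ℝ × UnitAddTorus d) × UnitAddTorus d =>
        ∑ i, ∑ j, ∑ k, FunctionSpaces.Torus.partialDeriv k (M i j) q.2 *
          ((u q.1.1 (q.1.2 + q.2) - u q.1.1 q.1.2) i * (u q.1.1 (q.1.2 + q.2) - u q.1.1 q.1.2) j *
            (u q.1.1 (q.1.2 + q.2) - u q.1.1 q.1.2) k)) (μT.prod volume) :=
      Finset.aestronglyMeasurable_fun_sum _ fun i _ => Finset.aestronglyMeasurable_fun_sum _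
        fun j _ => Finset.aestronglyMeasurable_fun_sum _ fun k _ =>
          (((hM i j).partialDeriv k).continuous.aestronglyMeasurable.comp_snd).mul
            (((hδi i).mul (hδi j)).mul (hδi k))
    exact hΨ.integral_prod_right'.mul hψm
  -- dominations, hence integrability
  have iA : Integrable (fun z : ℝ × UnitAddTorus d =>
      ⟪matConvCube (u z.1) M z.2, FunctionSpaces.Torus.gradient (ψ z.1) z.2⟫) μT := by
    refine (D1.const_mul (Fintype.card d * CK * Cg)).mono' mA ?_
    filter_upwards [hIoo, hgood] with z hz ht
    have hV := norm_matConvCube_le (M := M) ht hCM z.2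
    calc ‖⟪matConvCube (u z.1) M z.2, FunctionSpaces.Torus.gradient (ψ z.1) z.2⟫‖
        ≤ ‖matConvCube (u z.1) M z.2‖ * ‖FunctionSpaces.Torus.gradient (ψ z.1) z.2‖ :=
          norm_inner_le_norm _ _
      _ ≤ (Fintype.card d * (CK * ∫ y, ‖u z.1 y‖ ^ 3)) * Cg :=
          mul_le_mul hV (hCg z.1 (Ioo_subset_Icc_self hz) z.2) (norm_nonneg _) (by positivity)
      _ = Fintype.card d * CK * Cg * ∫ y, ‖u z.1 y‖ ^ 3 := by ring
  have iB : Integrable (fun z : ℝ × UnitAddTorus d =>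
      matConvSq (u z.1) M z.2 * ⟪u z.1 z.2, FunctionSpaces.Torus.gradient (ψ z.1) z.2⟫) μT := by
    refine (D2.const_mul (CK * Cg)).mono' mB ?_
    filter_upwards [hIoo, hgood] with z hz ht
    have hconv : ‖matConvSq (u z.1) M z.2‖ ≤ CK * ∫ y, ‖u z.1 y‖ ^ 2 :=
      norm_matConvSq_le (M := M) ht hCM z.2
    have hi : ‖⟪u z.1 z.2, FunctionSpaces.Torus.gradient (ψ z.1) z.2⟫‖ ≤ ‖u z.1 z.2‖ * Cg :=
      (norm_inner_le_norm _ _).trans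
        (mul_le_mul_of_nonneg_left (hCg z.1 (Ioo_subset_Icc_self hz) z.2) (norm_nonneg _))
    have hN0 : 0 ≤ ∫ y, ‖u z.1 y‖ ^ 2 := integral_nonneg fun y => sq_nonneg _
    rw [norm_mul]
    calc ‖matConvSq (u z.1) M z.2‖ * ‖⟪u z.1 z.2, FunctionSpaces.Torus.gradient (ψ z.1) z.2⟫‖
        ≤ (CK * ∫ y, ‖u z.1 y‖ ^ 2) * (‖u z.1 z.2‖ * Cg) :=
          mul_le_mul hconv hi (norm_nonneg _) (by positivity)
      _ = CK * Cg * ((∫ y, ‖u z.1 y‖ ^ 2) * ‖u z.1 z.2‖) := by ring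
  have iE : Integrable (fun z : ℝ × UnitAddTorus d =>
      ⟪u z.1 z.2, matConv (u z.1) M z.2⟫ * ⟪u z.1 z.2, FunctionSpaces.Torus.gradient (ψ z.1) z.2⟫) μT := by
    refine (D3.const_mul (CK * Cg)).mono' mE ?_
    filter_upwards [hIoo, hgood] with z hz ht
    have hv := norm_matConv_le (M := M) (ht.integrable (by norm_num)) hCM z.2
    have hi : ‖⟪u z.1 z.2, FunctionSpaces.Torus.gradient (ψ z.1) z.2⟫‖ ≤ ‖u z.1 z.2‖ * Cg :=
      (norm_inner_le_norm _ _).trans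
        (mul_le_mul_of_nonneg_left (hCg z.1 (Ioo_subset_Icc_self hz) z.2) (norm_nonneg _))
    have h1 : ‖⟪u z.1 z.2, matConv (u z.1) M z.2⟫‖ ≤ ‖u z.1 z.2‖ * (CK * ∫ y, ‖u z.1 y‖) :=
      (norm_inner_le_norm _ _).trans (mul_le_mul_of_nonneg_left hv (norm_nonneg _))
    have hN0 : 0 ≤ ∫ y, ‖u z.1 y‖ := integral_nonneg fun y => norm_nonneg _
    rw [norm_mul]
    calc ‖⟪u z.1 z.2, matConv (u z.1) M z.2⟫‖ * ‖⟪u z.1 z.2, FunctionSpaces.Torus.gradient (ψ z.1) z.2⟫‖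
        ≤ (‖u z.1 z.2‖ * (CK * ∫ y, ‖u z.1 y‖)) * (‖u z.1 z.2‖ * Cg) :=
          mul_le_mul h1 hi (norm_nonneg _) (by positivity)
      _ = CK * Cg * ((∫ y, ‖u z.1 y‖) * ‖u z.1 z.2‖ ^ 2) := by ring
  have iK : Integrable (fun z : ℝ × UnitAddTorus d => matKernelFlux M (u z.1) z.2 * ψ z.1 z.2) μT := by
    refine ((D1.add I3).const_mul (4 * CK' * Cψ)).mono' mK ?_
    filter_upwards [hIoo, hgood] with z hz ht
    have hk := abs_matKernelFlux_le (M := M) ht hCM' z.2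
    have hψz : ‖ψ z.1 z.2‖ ≤ Cψ := hCψ z.1 (Ioo_subset_Icc_self hz) z.2
    have hN0 : 0 ≤ (∫ y, ‖u z.1 y‖ ^ 3) + ‖u z.1 z.2‖ ^ 3 :=
      add_nonneg (integral_nonneg fun y => pow_nonneg (norm_nonneg _) _) (pow_nonneg (norm_nonneg _) _)
    rw [norm_mul, Real.norm_eq_abs]
    calc |matKernelFlux M (u z.1) z.2| * ‖ψ z.1 z.2‖
        ≤ (4 * CK' * ((∫ y, ‖u z.1 y‖ ^ 3) + ‖u z.1 z.2‖ ^ 3)) * Cψ :=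
          mul_le_mul hk hψz (norm_nonneg _) (by positivity)
      _ = 4 * CK' * Cψ * ((∫ y, ‖u z.1 y‖ ^ 3) + ‖u z.1 z.2‖ ^ 3) := by ring
  -- the slice functionals are integrable in time
  have ia := iA.integral_prod_left
  have ib := iB.integral_prod_left
  have ie := iE.integral_prod_left
  have ik := iK.integral_prod_left
  -- the slice identity for a.e. `t`, and integrability of the convective term
  have hid : ∀ᵐ t ∂μ, (∫ x, matKernelFlux M (u t) x * ψ t x) =
      (∫ x, ⟪matConvCube (u t) M x, FunctionSpaces.Torus.gradient (ψ t) x⟫) -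
      (∫ x, matConvSq (u t) M x * ⟪u t x, FunctionSpaces.Torus.gradient (ψ t) x⟫) +
      2 * (∫ x, ⟪u t x, matConv (u t) M x⟫ * ⟪u t x, FunctionSpaces.Torus.gradient (ψ t) x⟫) -
      2 * ∫ x, ⟪u t x, FunctionSpaces.Torus.convect (u t) (matSymmTestField M (ψ t) (u t)) x⟫ := by
    filter_upwards [hslice3, hdiv] with t ht hdt
    exact integral_matKernelFlux_mul_slice hM hMev hMsymm ht hdt (hψ.isSpaceTimeTest.isSmooth_slice t)
  have ic : Integrable (fun t => ∫ x,
      ⟪u t x, FunctionSpaces.Torus.convect (u t) (matSymmTestField M (ψ t) (u t)) x⟫) μ := by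
    refine (((ia.sub ib).add (ie.const_mul 2)).sub ik).const_mul 2⁻¹ |>.congr ?_
    filter_upwards [hid] with t ht
    simp only [Pi.sub_apply, Pi.add_apply]
    rw [ht]
    ring
  -- splitting the time integral
  have h1 : Integrable (fun t =>
      (∫ x, ⟪matConvCube (u t) M x, FunctionSpaces.Torus.gradient (ψ t) x⟫) -
      (∫ x, matConvSq (u t) M x * ⟪u t x, FunctionSpaces.Torus.gradient (ψ t) x⟫)) μ :=
    ia.sub ib
  have h2 : Integrable (fun t =>
      (∫ x, ⟪matConvCube (u t) M x, FunctionSpaces.Torus.gradient (ψ t) x⟫) -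
      (∫ x, matConvSq (u t) M x * ⟪u t x, FunctionSpaces.Torus.gradient (ψ t) x⟫) +
      2 * (∫ x, ⟪u t x, matConv (u t) M x⟫ * ⟪u t x, FunctionSpaces.Torus.gradient (ψ t) x⟫)) μ :=
    h1.add (ie.const_mul 2)
  rw [integral_congr_ae hid, integral_sub h2 (ic.const_mul 2), integral_add h1 (ie.const_mul 2),
    integral_sub ia ib, integral_const_mul, integral_const_mul]

end SpaceTime


end Literature.Analysis.FluidPDE.Torus
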